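import Literature.NumberTheory.GaloisRepresentations.CrystallineOrdinary
import Literature.NumberTheory.GaloisRepresentations.ResidualGaloisRep
import Literature.NumberTheory.GaloisRepresentations.AbsGaloisGroup
import HarnessLib

/-!
# Calegari's parallel-weight theorem for ordinary two-dimensional representations of an imaginary
# quadratic field with large residual image (Calegari 2010, Theorem 1.4)

Topic `Literature/NumberTheory/GaloisRepresentations`.  NAMED FACT (D-0014): a published theorem
vendored as a `Prop` with a body, no proof; users take `(h : Calegari2010_thm_1_4)`.

F. Calegari, *Even Galois representations and the Fontaine–Mazur conjecture*, Invent. Math. 185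
(2011) 1–16 (= arXiv:0907.3427; the theorem is stated on p. 2 and proved in §2, "The tensor
representation", with the residual-image computation in §6), Theorem 1.4, verbatim:

> "Let K/Q be an imaginary quadratic field, and let ρ : G_K → GL₂(O) be a continuous irreducible
> geometric Galois representation. […]
> 1.4. Theorem. Let ρ : G_K → GL₂(O) be a continuous irreducible geometric Galois
> representation. Suppose that p > 7 splits in K, and, furthermore, that
> (1) ρ|D_v is ordinary for v|p, with Hodge–Tate weights (0, m) and (0, n), where m, n > 0.
> (2) The residual representation ρ̄ has image containing SL₂(F_p), and the projective
> representation Proj(ρ̄) : G_K → PGL₂(F̄) does not extend to G_Q.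
> Then m = n."

(`O` = the integers of a finite extension of `ℚ_p`; the two pairs of weights are those at the two
places `v ≠ w` of `K` above the split prime `p`.)  This is the ordinary, big-image,
non-base-change case of the "parallel weight" prediction of Calegari–Mazur (J. Inst. Math.
Jussieu 8 (2009), Conj. 1.3 and §2.4): by the Borel–Wallach vanishing theorem no cuspidal
automorphic representation of `GL₂(𝔸_K)` can have the infinity type that a non-parallel `ρ` would
require, so Fontaine–Mazur–Langlands predicts that such `ρ` do not exist.  It grounds (the ordinary,
`SL₂(𝔽_p)`-image sub-case of) the items `LocallyReducibleParallel` and `TensorSquareParallel` of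
route `Summits/Langlands/Langlands/Theses/NonParallelVoid.lean`
(`Summit.Langlands.Langlands.Theses.NonParallelVoid.LocallyReducibleParallel`,
`….TensorSquareParallel`), whose mechanism (tensor induction `ψ = ρ ⊗ ρᶜ` extended to `G_ℚ`,
potential automorphy over a totally real field, `∧²`, sign at complex conjugation) is Calegari's §2.

## Rendering of the hypotheses (tree vocabulary; every deviation is a SPECIALISATION of print)

* `K` imaginary quadratic: `[Algebra.IsQuadraticExtension ℚ F]` and `NumberField.IsTotallyComplex F`
  (as in the route's items).  Coefficients: `ρ : FramedGaloisRep F ℚ̄_p 2` (`ℚ̄_p = PadicAlgCl p`);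
  a representation into `GL₂(O)`, `O ⊂ ℚ̄_p`, is one into `GL₂(ℚ̄_p)`, and conversely the image
  of the compact group `Γ_F` always has a model over some finite `E/ℚ_p` (not needed to STATE the
  fact; the printed `O`-form is the general one).
* "continuous irreducible geometric": continuity is built into `FramedGaloisRep`;
  `ρ.toGaloisRep.IsIrreducible`; "geometric" (Fontaine–Mazur: unramified outside a finite set and
  potentially semistable above `p`) is rendered by `∀ᶠ v in cofinite, ρ.IsUnramifiedAt v` — the
  potential semistability above `p` is implied by hypothesis (1) (an ordinary representation in
  the sense below is semistable, Perrin-Riou; cf. the docstring of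
  `FramedRep.IsCrystallineOrdinaryOfExponents`).
* "`p > 7` splits in `K`": `7 < p` and two DISTINCT places `v ≠ w` of `F` containing `p` (for
  `[F : ℚ] = 2` this is exactly "`p` splits", and then `{v, w}` is the set of places above `p` and
  `F_v = F_w = ℚ_p`).
* (1) "ρ|D_v ordinary with Hodge–Tate weights `(0, m)`", `m > 0`.  Calegari fixes (§2.1, p. 4)
  "the convention that the Hodge–Tate weight of ε|G_{ℚ_p} [is] 1", and "ordinary" is meant as in
  his reference [5] (Barnet-Lamb–Geraghty–Harris–Taylor; a `G_{K_v}`-stable line, the diagonal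
  characters being an integral power of `ε` times a character of finite order on inertia — here
  specialised to UNRAMIFIED `ψ_i`, the tree's accepted
  `FramedRep.IsCrystallineOrdinaryOfExponents p (ρ.toLocal v) b`: upper triangular in some frame
  with diagonal `ψ₁ ε^{b 0}`, `ψ₂ ε^{b 1}`, `ψ_i` unramified).  With `HT(ε) = 1` the weights
  `(0, m)` are the exponents `b = (m, 0)`: the invariant line carries `ψ₁ ε^m` (the larger power of
  `ε`, the geometric = Bloch–Kato-finite direction of the extension, exactly the tree's convention
  "STRICTLY DECREASING `b`"), the quotient is unramified.  So (1) becomes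
  `(ρ.toLocal v).IsCrystallineOrdinaryOfExponents p ![m, 0]` and `(ρ.toLocal w).… ![n, 0]`,
  `0 < m`, `0 < n`.  (In the tree's own Hodge–Tate convention `HT(ε) = -1`, used by
  `Literature.NumberTheory.PAdicHodge` / `labelledHodgeTateWeights`, these representations have
  labelled weights `{-m, 0}` at `v` and `{-n, 0}` at `w`; the conclusion `m = n` — equality of the
  two GAPS — is insensitive to the sign convention and to twisting `ρ` by an algebraic Hecke
  character of `K`, which is how a general pair of weight-pairs `{a, a+m}`, `{a', a'+n}` is
  normalised to Calegari's `(0, m)`, `(0, n)`; that normalisation is NOT part of this fact.)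
* (2a) "ρ̄ has image containing `SL₂(𝔽_p)`" (up to conjugacy — `ρ̄` is only defined up to
  conjugacy; the tree's `ρ.residualRep : Γ_F →* GL₂(ℤ̄_p/𝔪)` is a CHOSEN semisimplified
  reduction, `ResidualGaloisRep.lean`): some conjugate `g · SL₂(𝔽_p) · g⁻¹` lies in the image.
  Instance-free rendering of the subgroup `SL₂(𝔽_p) ≤ GL₂(ℤ̄_p/𝔪)`: it is the image of
  `SL₂(ℤ)` under entrywise reduction `Int.castRingHom` (the residue field has characteristic `p`,
  and `SL₂(ℤ) → SL₂(ℤ/p)` is surjective), pushed into `GL₂` by `Matrix.SpecialLinearGroup.toGL`.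
* (2b) "Proj(ρ̄) does not extend to `G_ℚ`".  For `ρ̄` absolutely irreducible with
  `SL₂(𝔽_p) ≤ im ρ̄` (so that the centraliser of the projective image in `PGL₂(𝔽̄_p)` is
  trivial), `Proj(ρ̄)` extends to the index-two overgroup `G_ℚ = G_K ∪ τG_K` iff the
  `τ`-conjugate `ρ̄^τ = ρ̄ ∘ θ_τ` (`θ_τ(σ) = τστ⁻¹`) is projectively equivalent to `ρ̄`, i.e.
  `ρ̄^τ ≅ ρ̄ ⊗ χ̄` for a character `χ̄ : G_K → 𝔽̄_pˣ`, i.e. (Brauer–Nesbitt, `p > 2`) iff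
  `tr ρ̄(θ_τ σ) = χ̄(σ) tr ρ̄(σ)` and `det ρ̄(θ_τ σ) = χ̄(σ)² det ρ̄(σ)` for all `σ`.  This
  trace/determinant form, with `G_K ↪ G_ℚ` the tree's `absGaloisRestrict ℚ F` (injective,
  `absGaloisRestrict_injective`) and `θ_τ σ` the unique `σ'` with `res σ' = τ (res σ) τ⁻¹`, is
  VERBATIM the "base-change type" clause of the route's items `EmptyWeightCore` /
  `TensorSquareParallel`; hypothesis (2b) is its negation.

## What is NOT claimed here

Nothing beyond the printed theorem: non-ordinary `ρ`, residual images not containing `SL₂(𝔽_p)`,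
`p ≤ 7`, `p` inert or ramified, and residually base-change-type `ρ̄` are exactly the cases the
route's other cruxes address.  A second printed source for the ordinary big-image case is
Allen–Calegari–Caraiani–Gee–Helm–Le Hung–Newton–Scholze–Taylor–Thorne, *Potential automorphy over
CM fields*, Ann. of Math. 197 (2023), Thm. 6.1.2 with Remark 6.1.3 ("it follows from the existence
of Π that the weight λ is conjugate self-dual up to twist … λ_{τ,i} + λ_{τc,n+1-i} = w"), under
its own residual hypotheses (decomposed generic, enormous image, residually ordinarily
automorphic); it is not vendored here.

## References

* [Calegari2010] F. Calegari, *Even Galois representations and the Fontaine–Mazur conjecture*,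
  Invent. Math. 185 (2011) 1–16, doi:10.1007/s00222-010-0297-0 = arXiv:0907.3427 — Thm. 1.4
  (p. 2), §2 (pp. 3–5), §2.1 (HT convention, p. 4), §6.  Read 2026-08-16 (arXiv text).
* [CalegariMazur2008] F. Calegari, B. Mazur, *Nearly ordinary Galois deformations over arbitrary
  number fields*, J. Inst. Math. Jussieu 8 (2009), Conj. 1.3, §2.4.
* [ACCGHLNSTT2023] P. Allen et al., Ann. of Math. 197 (2023), Thm. 6.1.2, Rem. 6.1.3 (held:
  arXiv:1812.09999, read 2026-08-16).
-/

noncomputable section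

open Field IsDedekindDomain
open scoped NumberField MatrixGroups

namespace Literature.NumberTheory.GaloisRepresentations

/-- **Calegari 2010, Theorem 1.4** (Invent. Math. 185 (2011), p. 2 of arXiv:0907.3427): "Let
ρ : G_K → GL₂(O) be a continuous irreducible geometric Galois representation [K/ℚ imaginary
quadratic]. Suppose that p > 7 splits in K, and, furthermore, that (1) ρ|D_v is ordinary for v|p,
with Hodge–Tate weights (0, m) and (0, n), where m, n > 0. (2) The residual representation ρ̄ has
image containing SL₂(F_p), and the projective representation Proj(ρ̄) : G_K → PGL₂(F̄) does not
extend to G_ℚ. Then m = n."  Rendering (module docstring): `F` imaginary quadratic; `7 < p`;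
`v ≠ w` the two places above `p`; (1) = crystalline-ordinary of exponents `(m, 0)` at `v` and
`(n, 0)` at `w` in Calegari's convention `HT(ε) = 1` (invariant line `ψ₁ε^m`, unramified
quotient; `ψ_i` unramified — a specialisation of [5]'s "finite order on inertia"); (2a) = the
image of the chosen residual representation contains a conjugate of `SL₂(𝔽_p)` = the reduction of
`SL₂(ℤ)`; (2b) = NOT of base-change type in trace/determinant form (no `τ ∈ G_ℚ ∖ G_K` and
`χ̄` with `tr ρ̄(τστ⁻¹) = χ̄(σ) tr ρ̄(σ)`, `det ρ̄(τστ⁻¹) = χ̄(σ)² det ρ̄(σ)`), equivalent to the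
printed clause under (2a) by Brauer–Nesbitt.  Grounds
`Summit.Langlands.Langlands.Theses.NonParallelVoid.LocallyReducibleParallel` (ordinary,
`SL₂(𝔽_p)`-image, non-base-change sub-case; the item is STRONGER: any residual image, any `p`,
nearly ordinary) and the ordinary case of `….TensorSquareParallel`.
[cite: Calegari2010, Thm 1.4] -/
def Calegari2010_thm_1_4 : Prop :=
  ∀ (F : Type) [Field F] [NumberField F] [Algebra.IsQuadraticExtension ℚ F],
    NumberField.IsTotallyComplex F →
  ∀ (p : ℕ) [Fact p.Prime], 7 < p →
  ∀ (ρ : FramedGaloisRep F (PadicAlgCl p) 2),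
    ρ.toGaloisRep.IsIrreducible →
    (∀ᶠ v : HeightOneSpectrum (𝓞 F) in Filter.cofinite, ρ.IsUnramifiedAt v) →
  ∀ (v w : HeightOneSpectrum (𝓞 F)), v ≠ w →
    ((p : ℕ) : 𝓞 F) ∈ v.asIdeal → ((p : ℕ) : 𝓞 F) ∈ w.asIdeal →
  ∀ (m n : ℕ), 0 < m → 0 < n →
    (ρ.toLocal v).IsCrystallineOrdinaryOfExponents p ![(m : ℤ), 0] →
    (ρ.toLocal w).IsCrystallineOrdinaryOfExponents p ![(n : ℤ), 0] →
    (∃ g : GL (Fin 2) (padicAlgClResidueField p),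
      ∀ M : Matrix.SpecialLinearGroup (Fin 2) ℤ, ∃ σ : absoluteGaloisGroup F,
        ρ.residualRep σ =
          g * Matrix.SpecialLinearGroup.toGL
            (Matrix.SpecialLinearGroup.map (Int.castRingHom (padicAlgClResidueField p)) M) * g⁻¹) →
    ¬ (∃ τ : absoluteGaloisGroup ℚ, τ ∉ Set.range (absGaloisRestrict ℚ F) ∧
        ∃ χ : absoluteGaloisGroup F →* (padicAlgClResidueField p)ˣ,
          ∀ σ σ' : absoluteGaloisGroup F,
            absGaloisRestrict ℚ F σ' = τ * absGaloisRestrict ℚ F σ * τ⁻¹ →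
              (ρ.residualRep σ').val.trace =
                  (χ σ : padicAlgClResidueField p) * (ρ.residualRep σ).val.trace ∧
              (ρ.residualRep σ').val.det =
                  (χ σ : padicAlgClResidueField p) ^ 2 * (ρ.residualRep σ).val.det) →
    m = n

end Literature.NumberTheory.GaloisRepresentations
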